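import Mathlib
import Summits.ValiantsHypothesis.ValiantsHypothesis.Theorems.BarrierLeverPartitionMinorsHitByVPHiddenStatesJoinUniform
import Summits.ValiantsHypothesis.ValiantsHypothesis.Theorems.BarrierLeverPartitionMinorsHitByVPHiddenStatesFit
import Summits.ValiantsHypothesis.ValiantsHypothesis.Theorems.BarrierLeverPartitionMinorsHitByVPSimplexJoinNodes

/-!
# Route BarrierLever — item `PartitionMinorsHitByVP` (stmt-ValiantsHypothesis-19717):
# the UNIFORM-MENU nodes (typed; not asserted) and their arrows to the registered nodes and to the item

Link file (`--supports stmt-ValiantsHypothesis-19717`; cell valiant-natproofs, rung V4, 𝒟-side door (c), line `hidden_states`;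
prover seat val-np-p3 gen 11). Two `Prop` definitions in the cell's one-exchange format (NOT asserted) and kernel arrows.

After `…HiddenStatesJoinUniform` (p622521) and `…SimplexJoinUniform` (p621024) the item reduces, through either door, to
«for every (h, r) ONE design within budget all of whose pieces are UNIFORM» (a piece is uniform when it is good on EVERY
injective row family of its size). This file names that reduced statement for each door and proves the arrows:

* `Stmt.uniformMenuWide` — wide join door: `m ≤ 2h` pieces, `K ≤ h³` states, legal (join threshold family), every piece uniform;
  `universalJoinWide_of_uniformMenuWide : Stmt.uniformMenuWide → SymbJoin.Stmt.universalJoinWide` (= the body of the line's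
  registered node `stub_universalJoinWide`, whence the crux by the line's `PartitionMinorsHitByVP_of`, `b = 8`).
* `Stmt.uniformMenuSimplex` — exact-support simplex-product door: `m ≤ (2h)²`, `D ≤ 2h`, `N ≤ (2h)²`, every piece uniform;
  `simplexUniversal_of_uniformMenuSimplex`, `partitionMinorsHitByVP_of_uniformMenuSimplex` (`b = 10`).

WHAT IS KNOWN (seat memo §9–§10): simplices / generic points are uniform (`…SimplexJoinUniformSimplex`); a piece is uniform only if
it passes the tensor-level and packing counts (T+P) (`…SimplexJoinTwoWide` is the kernel form of the first of these); numerically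
(kit census h ≤ 12, 70+ shapes, 0 disagreements) exactly the (T+P)-clean pieces are uniform, clean pieces exist at every scale
(h = 64: hundreds of decaying mixed products), and 2–4 of them sum to any r. CONJECTURE UM: (T+P)-clean ⇒ uniform.
WHAT THIS IS NOT: the menus are OPEN; item 19717 stays OPEN; nothing on crux 14610 or VP ≠ VNP.
-/

set_option linter.dupNamespace false

namespace Summit.ValiantsHypothesis.ValiantsHypothesis.Theorems.BarrierLever.SimplexJoin

open Finset Matrix

/-- **NODE (wide join door): a legal wide design with uniform pieces for every `(h, r)`.** For all large `h` and every
`r ≤ 2^h` there are `m ≤ 2h` pieces on `K ≤ h³` states, an injective `e : Fin r → Fin m × Finset (Fin K)` that is a join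
threshold family for some weights `(W, wt)`, such that EVERY piece is uniform: every bijective enumeration `c` of its columns is
good, for some table, on EVERY injective row family of the same size. Typed, not asserted. -/
def Stmt.uniformMenuWide : Prop :=
  ∃ h₁ : ℕ, ∀ h : ℕ, h₁ ≤ h → ∀ r : ℕ, r ≤ 2 ^ h →
    ∃ (m K : ℕ) (W : Fin m → ℕ) (wt : Fin m → Fin K → ℕ) (e : Fin r → Fin m × Finset (Fin K)),
      m ≤ h + h ∧ K ≤ h * h * h ∧ Function.Injective e ∧
      (∀ x : Fin m × Finset (Fin K), x ∉ Set.range e →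
        ∀ i, W (e i).1 + ∑ k ∈ (e i).2, wt (e i).1 k < W x.1 + ∑ k ∈ x.2, wt x.1 k) ∧
      ∀ (p : Fin m) (n : ℕ) (c : Fin n → Fin r), Function.Injective c → (∀ x, (e (c x)).1 = p) →
        (∀ k, (e k).1 = p → ∃ x, c x = k) → ∀ v : Fin n → Finset (Fin h), Function.Injective v →
          ∃ t : Option (Fin K) → Fin h → ℂ,
            (Matrix.of fun x x' : Fin n => ∏ a ∈ v x,
              (t none a + ∑ q ∈ (e (c x')).2, t (some q) a)).det ≠ 0

/-- **The registered node from the wide uniform menu** (`good_of_uniform_pieces_join`). -/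
theorem universalJoinWide_of_uniformMenuWide (H : Stmt.uniformMenuWide) : HiddenStates.SymbJoin.Stmt.universalJoinWide := by
  obtain ⟨h₁, H⟩ := H
  refine ⟨h₁, fun h hh r hr => ?_⟩
  obtain ⟨m, K, W, wt, e, hm, hK, he, hthr, hU⟩ := H h hh r hr
  exact ⟨m, K, W, wt, e, hm, hK, he, hthr, fun u hu => good_of_uniform_pieces_join h m K r u e hu he hU⟩

/-- **NODE (simplex-product door): a simplex-product design with uniform pieces for every `(h, r)`.** For all large `h`
and every `r ≤ 2^h` there is a design of the exact-support door (`m ≤ (2h)²` pieces, `D ≤ 2h` factor slots, `N ≤ (2h)²` options,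
live sets `S`, exact injective enumeration `e`) all of whose pieces are uniform. Typed, not asserted. -/
def Stmt.uniformMenuSimplex : Prop :=
  ∃ h₁ : ℕ, ∀ h : ℕ, h₁ ≤ h → ∀ r : ℕ, r ≤ 2 ^ h →
    ∃ (m D N : ℕ) (S : Fin m → Fin D → Finset (Fin N)) (e : Fin r → Fin m × (Fin D → Option (Fin N))),
      m ≤ (h + h) ^ 2 ∧ D ≤ h + h ∧ N ≤ (h + h) ^ 2 ∧ Function.Injective e ∧
      (∀ c : Fin m × (Fin D → Option (Fin N)),
        c ∈ Set.range e ↔ ∀ (f : Fin D) (j : Fin N), c.2 f = some j → j ∈ S c.1 f) ∧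
      ∀ (p : Fin m) (n : ℕ) (c : Fin n → Fin r), Function.Injective c → (∀ x, (e (c x)).1 = p) →
        (∀ k, (e k).1 = p → ∃ x, c x = k) → ∀ v : Fin n → Finset (Fin h), Function.Injective v →
          ∃ t : Option (Fin D × Fin N) → Fin h → ℂ,
            (Matrix.of fun x x' : Fin n => ∏ a ∈ v x,
              (t none a + ∑ f : Fin D, ((e (c x')).2 f).elim 0 fun j => t (some (f, j)) a)).det ≠ 0

/-- **The simplex-product node from the simplex uniform menu** (`good_of_uniform_pieces`). -/
theorem simplexUniversal_of_uniformMenuSimplex (H : Stmt.uniformMenuSimplex) : Stmt.simplexUniversal := by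
  obtain ⟨h₁, H⟩ := H
  refine ⟨h₁, fun h hh r hr => ?_⟩
  obtain ⟨m, D, N, S, e, hm, hD, hN, he, hlive, hU⟩ := H h hh r hr
  exact ⟨m, D, N, S, e, hm, hD, hN, he, hlive, fun u hu => good_of_uniform_pieces h m D N r u e hu he hU⟩

/-- **Item 19717 from the simplex uniform menu** (`b = 10`, via `partitionMinorsHitByVP_of_simplexUniversal`). -/
theorem partitionMinorsHitByVP_of_uniformMenuSimplex (H : Stmt.uniformMenuSimplex) :
    Summit.ValiantsHypothesis.ValiantsHypothesis.Theses.BarrierLever.PartitionMinorsHitByVP :=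
  partitionMinorsHitByVP_of_simplexUniversal (simplexUniversal_of_uniformMenuSimplex H)

end Summit.ValiantsHypothesis.ValiantsHypothesis.Theorems.BarrierLever.SimplexJoin
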